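import Mathlib.RingTheory.DiscreteValuationRing.Basic
import HarnessLib

/-!
# The `ϖ`-socle of a quotient of a DVR is cyclic: `ϖ·a = 0`, `ϖ·b = 0`, `a ≠ 0 ⟹ b ∈ 𝒪·a` in `𝒪/ϖ^e`
# (the hypothesis `hP`/`hsoc` of the Lagrangian transfer for Howard 2004's level rings)

Topic `Algebra/Module`; namespace `Literature.Algebra.Module`. THEOREMS ONLY: no definition, no named fact, no
instance, no notation, no `sorry` (net debt 0). Cell `pub/bsd-print-x9` (print leaf G87 = Howard Thm. 1.6.1,
`thm161_dvrKolyvaginBound`), seat `bsd-line-x9-p1-w4` g16, brick (LEVEL-SOCLE).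

WHY. `LagrangianSubmodulesDeltaTransfer.forall_pow_smul_eq_zero_of_lagrangian` (Howard Lemmas 1.5.7/1.5.8/Prop. 1.5.9,
module side) takes `hP : ∀ p q : P, ϖ • p = 0 → ϖ • q = 0 → p ≠ 0 → ∃ r : 𝒪, q = r • p` («the `ϖ`-socle of the value
module `P` is a simple `𝒪/ϖ`-module, i.e. has at most one line»); its Galois-side instance
`Howard2004/InertLagrangianTransferProofs.forall_pow_smul_eq_zero_of_inert_local` uses `P :=` the level ring `R_k` of
`DVRSetting` (`hsoc`), and `Howard2004/DualityDatumLocalTwoSocleProofs.exists_eq_scalarMap_two_of_scalarMap_two_eq_zero`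
the multiplicative form.  For the level rings of `DVRSetting.SatisfiesH` (`algebraMap_surjective : Surjective (𝒪 → R_k)`)
this is the present file: **every quotient `R'` of a DVR `𝒪` (surjective `algebraMap 𝒪 R'`) has cyclic `ϖ`-socle** —
if the kernel is `(ϖ^{e+1})` then `ϖ x ∈ (ϖ^{e+1}) ⟹ x = ϖ^e z`, and `x ∉ (ϖ^{e+1}) ⟹ z ∈ 𝒪ˣ`, so any two socle
elements `ϖ^e z`, `ϖ^e w` differ by the scalar `w z⁻¹`; kernel `⊥` or `⊤` is degenerate.

  * `exists_eq_pow_mul_of_mul_mem_span_pow_succ` : `ϖ * x ∈ (ϖ^{e+1}) ⟹ ∃ z, x = ϖ^e * z` (domain);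
  * **`exists_smul_eq_of_uniformizer_smul_eq_zero`** : `Surjective (algebraMap 𝒪 R') ⟹
    ∀ a b : R', ϖ • a = 0 → ϖ • b = 0 → a ≠ 0 → ∃ c : 𝒪, b = c • a`;
  * `exists_mul_eq_of_algebraMap_uniformizer_mul_eq_zero` : the same with the image `ϖ' = algebraMap ϖ` and `c : R'`.

Nothing here concerns Selmer groups; `thm161_dvrKolyvaginBound` is NOT proved; no summit statement is proved.

## References

* [Howard2004HeegnerKolyvagin] B. Howard, *The Heegner point Kolyvagin system*, Compositio Math. 140 (2004),
  §1.1 («`R` a principal Artinian local ring», arXiv:1202.6340 p. 2 L40–48) and Lemma 1.5.7 (proof, p. 10 L105–140).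
* [Hungerford1974] T. W. Hungerford, *Algebra*, GTM 73, Ch. IV Lemma 6.10 (socles of `p`-primary cyclic modules).
-/

namespace Literature.Algebra.Module

section DVR

variable {𝒪 : Type*} [CommRing 𝒪] [IsDomain 𝒪] [IsDiscreteValuationRing 𝒪] {ϖ : 𝒪}
  {R' : Type*} [CommRing R'] [Algebra 𝒪 R']

omit [IsDiscreteValuationRing 𝒪] in
/-- In a domain, `ϖ ≠ 0` and `ϖ * x ∈ (ϖ^{e+1})` give `x = ϖ^e * z` for some `z`.
[cite: Hungerford1974, Ch. IV Lemma 6.10 (PDF p. 305)] -/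
theorem exists_eq_pow_mul_of_mul_mem_span_pow_succ (hϖ : ϖ ≠ 0) {e : ℕ} {x : 𝒪}
    (h : ϖ * x ∈ Ideal.span ({ϖ ^ (e + 1)} : Set 𝒪)) : ∃ z : 𝒪, x = ϖ ^ e * z := by
  obtain ⟨z, hz⟩ := Ideal.mem_span_singleton'.1 h
  refine ⟨z, mul_left_cancel₀ hϖ ?_⟩
  rw [← hz]
  ring

/-- **The `ϖ`-socle of a quotient of a DVR is cyclic.**  If `algebraMap 𝒪 R'` is surjective (`R' ≅ 𝒪/I`) then for
`a b : R'` with `ϖ • a = 0`, `ϖ • b = 0` and `a ≠ 0` there is `c : 𝒪` with `b = c • a` — the hypothesis `hP` of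
`forall_pow_smul_eq_zero_of_lagrangian` / `hsoc` of `Howard2004/InertLagrangianTransferProofs` for the level rings
`R_k` of `Howard2004.DVRSetting` (`SatisfiesH.algebraMap_surjective`).
[cite: Howard2004HeegnerKolyvagin, §1.1 (arXiv:1202.6340 p. 2 L40–48) and Lemma 1.5.7 (p. 10 L133–140)]
[cite: Hungerford1974, Ch. IV Lemma 6.10 (PDF p. 305)] -/
theorem exists_smul_eq_of_uniformizer_smul_eq_zero (hϖ : Irreducible ϖ)
    (hsurj : Function.Surjective (algebraMap 𝒪 R')) :
    ∀ a b : R', ϖ • a = 0 → ϖ • b = 0 → a ≠ 0 → ∃ c : 𝒪, b = c • a := by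
  intro a b ha hb ha0
  obtain ⟨x, rfl⟩ := hsurj a
  obtain ⟨y, rfl⟩ := hsurj b
  rw [Algebra.smul_def, ← map_mul, ← RingHom.mem_ker] at ha hb
  have hxI : x ∉ RingHom.ker (algebraMap 𝒪 R') := fun h => ha0 (RingHom.mem_ker.1 h)
  by_cases hbot : RingHom.ker (algebraMap 𝒪 R') = ⊥
  · rw [hbot, Ideal.mem_bot] at ha
    exact absurd (by rw [(mul_eq_zero.1 ha).resolve_left hϖ.ne_zero, map_zero]) ha0
  obtain ⟨n, hn⟩ := IsDiscreteValuationRing.ideal_eq_span_pow_irreducible hbot hϖ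
  rcases n with _ | e
  · exact absurd (by rw [hn, pow_zero, Ideal.span_singleton_one]; exact Submodule.mem_top) hxI
  rw [hn] at ha hb hxI
  obtain ⟨u, hu⟩ := exists_eq_pow_mul_of_mul_mem_span_pow_succ hϖ.ne_zero ha
  obtain ⟨w, hw⟩ := exists_eq_pow_mul_of_mul_mem_span_pow_succ hϖ.ne_zero hb
  have hunit : IsUnit u := by
    by_contra hnu
    apply hxI
    have humem : u ∈ IsLocalRing.maximalIdeal 𝒪 := (IsLocalRing.mem_maximalIdeal u).2 (mem_nonunits_iff.2 hnu)
    rw [(IsDiscreteValuationRing.irreducible_iff_uniformizer ϖ).1 hϖ, Ideal.mem_span_singleton'] at humem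
    obtain ⟨t, ht⟩ := humem
    rw [Ideal.mem_span_singleton', hu, ← ht]
    exact ⟨t, by ring⟩
  obtain ⟨v, hv⟩ := hunit
  refine ⟨w * ↑v⁻¹, ?_⟩
  rw [Algebra.smul_def, ← map_mul, hw, hu, ← hv]
  congr 1
  calc ϖ ^ e * w = w * (↑v⁻¹ * ↑v) * ϖ ^ e := by rw [Units.inv_mul, mul_one, mul_comm]
    _ = w * ↑v⁻¹ * (ϖ ^ e * ↑v) := by ring

/-- Multiplicative form with the image uniformizer `ϖ' = algebraMap 𝒪 R' ϖ` (the shape `hsoc` of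
`Howard2004/DualityDatumLocalTwoSocleProofs.exists_eq_scalarMap_two_of_scalarMap_two_eq_zero`): for `a b : R'` with
`ϖ' * a = 0`, `ϖ' * b = 0`, `a ≠ 0` there is `c : R'` with `b = c * a`.
[cite: Howard2004HeegnerKolyvagin, Lemma 1.5.7 (arXiv:1202.6340 p. 10 L133–140)] -/
theorem exists_mul_eq_of_algebraMap_uniformizer_mul_eq_zero (hϖ : Irreducible ϖ)
    (hsurj : Function.Surjective (algebraMap 𝒪 R')) :
    ∀ a b : R', algebraMap 𝒪 R' ϖ * a = 0 → algebraMap 𝒪 R' ϖ * b = 0 → a ≠ 0 → ∃ c : R', b = c * a := by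
  intro a b ha hb ha0
  rw [← Algebra.smul_def] at ha hb
  obtain ⟨c, hc⟩ := exists_smul_eq_of_uniformizer_smul_eq_zero hϖ hsurj a b ha hb ha0
  exact ⟨algebraMap 𝒪 R' c, by rw [hc, Algebra.smul_def]⟩

end DVR

end Literature.Algebra.Module
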